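import Summits.AnomalousDissipation.AnomalousDissipation.Theorems.ImpulseGridGridThesisStubAcdcDesignCalculus
import Summits.AnomalousDissipation.AnomalousDissipation.Theorems.ImpulseGridGridThesisStubAcdcDesignIntegrals

/-!
# Line `Sketch` for crux `GridSignsLaw` (item stmt-AnomalousDissipation-14349, route ImpulseGrid) —
stub `stub_acdcGridAdmissible`: the explicit AC/DC grid is an admissible `GridSignsLaw` design

The crux `GridSignsLaw` asks for ONE grid design `(Φ, Ψ, G, c)` satisfying fifteen design clauses
(smoothness of `Φ, Ψ, G`; `x₁,x₂`-invariance of `Φ` and `Ψ`; `∫Φ = 1`; `x₀`-invariance of `G`,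
`G₀ ≡ 0`, `div G = 0`; `∂₀Ψ = Φ − 1`; `∫ΦΨ‖G‖² = 0`; `Φ•G` smooth, divergence free and of zero
mean; `0 < c`) such that a sign law holds for all bounded-energy Leray–Hopf wakes. The lead
skeleton of line `Sketch` (reshape 3) discharges the `∃ design` with the explicit AC/DC grid of the
sibling `GridThesis` line: with the streamwise character `e₀ = e^{2πi x₀}`
(`UnitAddTorus.mFourier (Pi.single 0 1)`), the slab profile `Φ = 1 + 2θ cos 2πx₀ = 1 + 2θ Re e₀`,
its sawtooth `Ψ = (θ/π) sin 2πx₀ = (θ/π) Im e₀`, and the cellular two-mode Stokes pattern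
`G = A [sin 2πm(x₁+x₂) (e₁−e₂) + sin 2πm(x₁−x₂) (e₁+e₂)]` (sine Stokes modes at the frequencies
`(0, m, ±m)`), drift `c > 0`.

This file proves the registered stub `stub_acdcGridAdmissible`: these fields satisfy the fifteen
clauses, in the order of the route decl. Thirteen clauses are conjuncts of the tree theorems
`stub_acdcDesignCalculus` (file `ImpulseGridGridThesisStubAcdcDesignCalculus`) and
`stub_acdcDesignIntegrals` (file `ImpulseGridGridThesisStubAcdcDesignIntegrals`), applied with the
quadrature pair `C = (Re e₀) G`, `S = (Im e₀) G`. The two remaining ones: the `x₁,x₂`-invariance of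
`Φ` is that of the character `e₀`, whose frequency `(1, 0, 0)` has vanishing `1`st and `2`nd
components (`AcdcDesign.mFourier_add_single_of_apply_eq_zero`); and `∫Φ = 1 + 2θ ∫ Re e₀ = 1`
because `Re e₀` changes sign under the half-period translation `x₀ ↦ x₀ + ½`
(`AcdcDesign.mFourier_add_single_half`, `AcdcDesign.integral_eq_zero_of_forall_add_eq_neg`) and the
torus has total mass `1`. No new definitions.

References: Constantin–Foias 1988, Ch. 4 (4.13)–(4.14), (4.33) (Stokes eigenfields on the torus);
Grafakos 2014, §3.1.1 (characters of `T^d`).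
-/

noncomputable section

-- `Summit.<Summit>.<Problem>` is the tree's mandated summit-side namespace (CONVENTIONS §2); for this
-- single-conjunct summit the two coincide, so the duplicate is deliberate.
set_option linter.dupNamespace false

open MeasureTheory Set Filter Topology
open scoped InnerProductSpace RealInnerProductSpace

namespace Summit.AnomalousDissipation.AnomalousDissipation.Theorems

open Literature.Analysis.FluidPDE Literature.Analysis.FluidPDE.Torus
open Literature.Analysis.FunctionSpaces Literature.Analysis.FunctionSpaces.Torus

local notation "𝕋³" => UnitAddTorus (Fin 3)
local notation "E³" => EuclideanSpace ℝ (Fin 3)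

/-- **Stub `stub_acdcGridAdmissible` of line `Sketch` (crux `GridSignsLaw`,
stmt-AnomalousDissipation-14349): the explicit AC/DC grid is an admissible `GridSignsLaw` design.**
For `m ≥ 1`, `A, θ, c > 0`, the slab profile `Φ = 1 + 2θ cos 2πx₀`, its sawtooth
`Ψ = (θ/π) sin 2πx₀` and the cellular two-mode Stokes pattern
`G = A[sin 2πm(x₁+x₂)(e₁−e₂) + sin 2πm(x₁−x₂)(e₁+e₂)]` satisfy the fifteen design clauses of
`GridSignsLaw`, in the order of the route decl: smoothness of `Φ, Ψ, G`; `Φ` is `x₁,x₂`-invariant;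
`∫Φ = 1`; `Ψ` is `x₁,x₂`-invariant; `G` is `x₀`-invariant with `G₀ ≡ 0` and `div G = 0`;
`∂₀Ψ = Φ − 1`; `∫ΦΨ‖G‖² = 0`; `Φ•G` is smooth, divergence free and of zero mean; `0 < c`.
Thirteen of them are the tree's `stub_acdcDesignCalculus` / `stub_acdcDesignIntegrals` (with the
quadrature pair `C = cos(2πx₀)G`, `S = sin(2πx₀)G`); the `x₁,x₂`-invariance of `Φ` is
`AcdcDesign.mFourier_add_single_of_apply_eq_zero` (the frequency `(1,0,0)` of `e₀` has vanishing
transversal components), and `∫Φ = 1 + 2θ∫ Re e₀ = 1` is `∫ Re e₀ = 0` (half-period oddness of `e₀`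
in `x₀`, `AcdcDesign.mFourier_add_single_half`, `AcdcDesign.integral_eq_zero_of_forall_add_eq_neg`)
on the torus of total mass `1` (Constantin–Foias 1988, Ch. 4, (4.13)–(4.14), (4.33); Grafakos 2014,
§3.1.1). [folklore] -/
theorem stub_acdcGridAdmissible :
    ∀ (m : ℕ) (A θ c : ℝ) (Φ Ψ : 𝕋³ → ℝ) (G : 𝕋³ → E³),
      Φ = (fun x => 1 + 2 * θ * (UnitAddTorus.mFourier (Pi.single (0 : Fin 3) (1 : ℤ)) x).re) →
      Ψ = (fun x => θ / Real.pi * (UnitAddTorus.mFourier (Pi.single (0 : Fin 3) (1 : ℤ)) x).im) →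
      G = (fun x => A • (stokesMode ![(0 : ℤ), (m : ℤ), (m : ℤ)]
            (EuclideanSpace.single (1 : Fin 3) (1 : ℝ) - EuclideanSpace.single (2 : Fin 3) (1 : ℝ)) false x +
          stokesMode ![(0 : ℤ), (m : ℤ), -(m : ℤ)]
            (EuclideanSpace.single (1 : Fin 3) (1 : ℝ) + EuclideanSpace.single (2 : Fin 3) (1 : ℝ)) false x)) →
      1 ≤ m → 0 < A → 0 < θ → 0 < c →
      IsSmooth Φ ∧ IsSmooth Ψ ∧ IsSmooth G ∧
        (∀ (s : UnitAddCircle) x, Φ (x + Pi.single (1 : Fin 3) s) = Φ x ∧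
          Φ (x + Pi.single (2 : Fin 3) s) = Φ x) ∧
        (∫ x, Φ x = 1) ∧
        (∀ (s : UnitAddCircle) x, Ψ (x + Pi.single (1 : Fin 3) s) = Ψ x ∧
          Ψ (x + Pi.single (2 : Fin 3) s) = Ψ x) ∧
        (∀ (s : UnitAddCircle) x, G (x + Pi.single (0 : Fin 3) s) = G x) ∧ (∀ x, G x 0 = 0) ∧
        IsDivFree G ∧ (∀ x, partialDeriv 0 Ψ x = Φ x - 1) ∧
        (∫ x, Φ x * Ψ x * ‖G x‖ ^ 2 = 0) ∧
        IsSmooth (fun x => Φ x • G x) ∧ IsDivFree (fun x => Φ x • G x) ∧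
        HasZeroMean (fun x => Φ x • G x) ∧ 0 < c := by
  intro m A θ c Φ Ψ G hΦ hΨ hG hm hA hθ hc
  -- thirteen clauses from the tree, with the quadrature pair `C = (Re e₀) G`, `S = (Im e₀) G`
  obtain ⟨hΦs, hΨs, hGs, hΨinv, hGinv, hG0, hGdiv, hΨderiv, hfs, hfd, -⟩ :=
    stub_acdcDesignCalculus m A θ Φ Ψ G
      (fun x => (UnitAddTorus.mFourier (Pi.single (0 : Fin 3) (1 : ℤ)) x).re • G x)
      (fun x => (UnitAddTorus.mFourier (Pi.single (0 : Fin 3) (1 : ℤ)) x).im • G x)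
      hΦ hΨ hG rfl rfl hm hA hθ
  obtain ⟨hΦΨG, hfm, -⟩ :=
    stub_acdcDesignIntegrals m A θ Φ Ψ G
      (fun x => (UnitAddTorus.mFourier (Pi.single (0 : Fin 3) (1 : ℤ)) x).re • G x)
      (fun x => (UnitAddTorus.mFourier (Pi.single (0 : Fin 3) (1 : ℤ)) x).im • G x)
      hΦ hΨ hG rfl rfl hm hA hθ
  -- the streamwise character `e₀` is `x₁,x₂`-invariant, hence so is `Φ`
  have hχ : ∀ i : Fin 3, i ≠ 0 → ∀ (s : UnitAddCircle) (x : UnitAddTorus (Fin 3)),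
      UnitAddTorus.mFourier (Pi.single (0 : Fin 3) (1 : ℤ)) (x + Pi.single i s) =
        UnitAddTorus.mFourier (Pi.single (0 : Fin 3) (1 : ℤ)) x :=
    fun i hi s x => AcdcDesign.mFourier_add_single_of_apply_eq_zero (Pi.single_eq_of_ne hi _) x s
  have hΦinv : ∀ (s : UnitAddCircle) (x : UnitAddTorus (Fin 3)),
      Φ (x + Pi.single (1 : Fin 3) s) = Φ x ∧ Φ (x + Pi.single (2 : Fin 3) s) = Φ x := fun s x => by
    simp only [hΦ, hχ 1 (by decide) s x, hχ 2 (by decide) s x, and_self]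
  -- `∫ Re e₀ = 0`: `e₀` changes sign under the half-period translation `x₀ ↦ x₀ + ½`
  have hk1 : (Pi.single (0 : Fin 3) (1 : ℤ) : Fin 3 → ℤ) 0 ≠ 0 := by simp
  obtain ⟨t₂, he₂⟩ : ∃ t : UnitAddTorus (Fin 3), ∀ x : UnitAddTorus (Fin 3),
      UnitAddTorus.mFourier (Pi.single (0 : Fin 3) (1 : ℤ)) (x + t) =
        -UnitAddTorus.mFourier (Pi.single (0 : Fin 3) (1 : ℤ)) x :=
    ⟨_, AcdcDesign.mFourier_add_single_half hk1⟩
  have hRe : ∫ x, (UnitAddTorus.mFourier (Pi.single (0 : Fin 3) (1 : ℤ)) x).re = 0 :=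
    AcdcDesign.integral_eq_zero_of_forall_add_eq_neg _ t₂ fun x => by rw [he₂, Complex.neg_re]
  -- `∫Φ = ∫1 + 2θ ∫ Re e₀ = 1` on the torus of total mass `1`
  have hΦmass : ∫ x, Φ x = 1 := by
    have ir : Integrable (fun x : UnitAddTorus (Fin 3) =>
        2 * θ * (UnitAddTorus.mFourier (Pi.single (0 : Fin 3) (1 : ℤ)) x).re) volume :=
      (continuous_const.mul (Complex.continuous_re.comp
        (UnitAddTorus.mFourier (Pi.single (0 : Fin 3) (1 : ℤ))).continuous)).integrable_unitAddTorus
    simp only [hΦ]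
    rw [integral_add (integrable_const _) ir, integral_const_mul, hRe, mul_zero, add_zero]
    simp
  exact ⟨hΦs, hΨs, hGs, hΦinv, hΦmass, hΨinv, hGinv, hG0, hGdiv, hΨderiv, hΦΨG, hfs, hfd, hfm, hc⟩

end Summit.AnomalousDissipation.AnomalousDissipation.Theorems

end
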